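import Summits.ValiantsHypothesis.ValiantsHypothesis.Theorems.BarrierLeverPartitionMinorsHitByVPHiddenStatesBallCutCertKitFast

/-!
# Route BarrierLever — item `PartitionMinorsHitByVP` (stmt-ValiantsHypothesis-19717), line `hidden-states`:
# THE CLASSIFICATION ENGINE — coordinate types, count vectors, a COMPLETE budgeted enumerator, and «checked for every enumerated
# count vector ⇒ true for every 3-swap family»

Helper file (`--supports stmt-ValiantsHypothesis-19717`; cell valiant-natproofs, 𝒟-side door (c), registered line
`Cruxes/PartitionMinorsHitByVP/Lines/hidden_states.lean` v10; prover seat val-np-p6 gen 22).  Closes NO item; nothing is certified HERE.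

THE POINT (memo HOME/val-np-p6/g22/MEMO-valnp6-g22.md §7).  The TYPE of a coordinate `x` of a 3-swap family `(A, C)` is the 6-bit code of
`(x ∈ A_l)_l, (x ∈ C_l)_l` (`typeCode`).  A family is determined up to a permutation of the coordinates by its COUNT VECTOR
`τ ↦ #{x : typeCode x = τ}` (`exists_perm_typeCode_comp`: functions with equal fibre sizes are conjugate), and the family REBUILT from the
run-length list of a count vector (`famA`, `famC` of `rlFun`) is therefore a relabelling of `(A, C)` whose image under the permutation is
`(A, C)` (`map_famA_comp`).  `enumSeq alphabet R` enumerates ALL run-length type lists over `alphabet` with exact incidence budgets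
`R` (six numbers: `|A_l|`, `|C_l|`), and `rlList_mem_enumSeq` is its COMPLETENESS.  ★ `exists_table_of_checkCnt`: if the
Boolean `checkCnt` (shape hypotheses ⇒ `certCheckN` passes at one of the seeds, for the rebuilt family of every enumerated vector;
splittable into segments `checkSeg`, `checkCnt_of_checkSeg`) is `true`, then EVERY 3-swap
family on `Fin len` of that level whose types lie in the alphabet is served (standard form).  With the alphabet of the 44 UNBALANCED types
(`unbalancedTypes`, `typeCode_mem_unbalancedTypes`) this is exactly the hypothesis of `exists_table_threeSwap_of_unbalanced_le` at one
`(n, t)` — no isomorphism test, no symmetry reduction (the enumeration is ≤ 36 × the number of classes).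

HONEST LABEL: classification toolkit; 19717 stays OPEN; nothing on crux 14610 or VP ≠ VNP.
-/

set_option linter.dupNamespace false

namespace Summit.ValiantsHypothesis.ValiantsHypothesis.Theorems.BarrierLever.HiddenStates

open Finset

namespace BallCut

open MoorePeel

/-! ## 1. Coordinate types -/

/-- The 6-bit code of six Booleans. -/
def enc6 (b : Fin 6 → Bool) : ℕ := ∑ i : Fin 6, if b i then 2 ^ i.val else 0

/-- `enc6 b < 64`. -/
theorem enc6_lt (b : Fin 6 → Bool) : enc6 b < 64 := by
  revert b; decide

/-- The bits of `enc6 b` are `b`. -/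
theorem testBit_enc6 (b : Fin 6 → Bool) (i : Fin 6) : (enc6 b).testBit i.val = b i := by
  revert b i; decide

/-- The six membership bits of coordinate `x`: `[x ∈ A_0], [x ∈ A_1], [x ∈ A_2], [x ∈ C_0], [x ∈ C_1], [x ∈ C_2]`. -/
def typeBits {n : ℕ} (A C : Fin 3 → Finset (Fin n)) (x : Fin n) : Fin 6 → Bool :=
  ![decide (x ∈ A 0), decide (x ∈ A 1), decide (x ∈ A 2), decide (x ∈ C 0), decide (x ∈ C 1), decide (x ∈ C 2)]

/-- The TYPE of coordinate `x` in the 3-swap family `(A, C)`: bit `l` = `[x ∈ A_l]`, bit `3 + l` = `[x ∈ C_l]`. -/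
def typeCode {n : ℕ} (A C : Fin 3 → Finset (Fin n)) (x : Fin n) : Fin 64 := ⟨enc6 (typeBits A C x), enc6_lt _⟩

/-- Bit `l` of the type is membership in `A_l`. -/
theorem testBit_typeCode_A {n : ℕ} (A C : Fin 3 → Finset (Fin n)) (x : Fin n) (l : Fin 3) :
    (typeCode A C x).val.testBit l.val = decide (x ∈ A l) := by
  have h := testBit_enc6 (typeBits A C x) ⟨l.val, by omega⟩
  simp only [typeCode]
  rw [h]
  fin_cases l <;> rfl

/-- Bit `3 + l` of the type is membership in `C_l`. -/
theorem testBit_typeCode_C {n : ℕ} (A C : Fin 3 → Finset (Fin n)) (x : Fin n) (l : Fin 3) :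
    (typeCode A C x).val.testBit (3 + l.val) = decide (x ∈ C l) := by
  have h := testBit_enc6 (typeBits A C x) ⟨3 + l.val, by omega⟩
  simp only [typeCode]
  rw [h]
  fin_cases l <;> rfl

/-! ## 2. The family rebuilt from a type function -/

/-- The removed sets of the family rebuilt from a type function. -/
def famA {n : ℕ} (g : Fin n → Fin 64) (l : Fin 3) : Finset (Fin n) := Finset.univ.filter fun x => (g x).val.testBit l.val

/-- The added sets of the family rebuilt from a type function. -/
def famC {n : ℕ} (g : Fin n → Fin 64) (l : Fin 3) : Finset (Fin n) := Finset.univ.filter fun x => (g x).val.testBit (3 + l.val)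

/-- Rebuilding from types composed with a permutation `σ` and mapping by `σ` gives the removed sets back. -/
theorem map_famA_comp {n : ℕ} (A C : Fin 3 → Finset (Fin n)) (σ : Equiv.Perm (Fin n)) (l : Fin 3) :
    (famA (typeCode A C ∘ σ) l).map σ.toEmbedding = A l := by
  ext x
  simp only [famA, Finset.mem_map, Finset.mem_filter, Finset.mem_univ, true_and, Function.comp, Equiv.toEmbedding_apply,
    testBit_typeCode_A, decide_eq_true_eq]
  constructor
  · rintro ⟨y, hy, rfl⟩; exact hy
  · intro hx; exact ⟨σ.symm x, by simpa using hx, by simp⟩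

/-- Same for the added sets. -/
theorem map_famC_comp {n : ℕ} (A C : Fin 3 → Finset (Fin n)) (σ : Equiv.Perm (Fin n)) (l : Fin 3) :
    (famC (typeCode A C ∘ σ) l).map σ.toEmbedding = C l := by
  ext x
  simp only [famC, Finset.mem_map, Finset.mem_filter, Finset.mem_univ, true_and, Function.comp, Equiv.toEmbedding_apply,
    testBit_typeCode_C, decide_eq_true_eq]
  constructor
  · rintro ⟨y, hy, rfl⟩; exact hy
  · intro hx; exact ⟨σ.symm x, by simpa using hx, by simp⟩

/-- Rebuilding from types composed with an equivalence `φ` and mapping by `φ` gives the rebuilt family of the original types. -/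
theorem map_famA_equiv {m n : ℕ} (f : Fin n → Fin 64) (φ : Fin m ≃ Fin n) (l : Fin 3) :
    (famA (f ∘ φ) l).map φ.toEmbedding = famA f l := by
  ext x
  simp only [famA, Finset.mem_map, Finset.mem_filter, Finset.mem_univ, true_and, Function.comp, Equiv.toEmbedding_apply]
  constructor
  · rintro ⟨y, hy, rfl⟩; exact hy
  · intro hx; exact ⟨φ.symm x, by simpa using hx, by simp⟩

/-- Same for the added sets. -/
theorem map_famC_equiv {m n : ℕ} (f : Fin n → Fin 64) (φ : Fin m ≃ Fin n) (l : Fin 3) :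
    (famC (f ∘ φ) l).map φ.toEmbedding = famC f l := by
  ext x
  simp only [famC, Finset.mem_map, Finset.mem_filter, Finset.mem_univ, true_and, Function.comp, Equiv.toEmbedding_apply]
  constructor
  · rintro ⟨y, hy, rfl⟩; exact hy
  · intro hx; exact ⟨φ.symm x, by simpa using hx, by simp⟩

/-- Functions with fibres of equal sizes are conjugate by a permutation. -/
theorem exists_perm_comp_eq {n : ℕ} {β : Type*} [DecidableEq β] (f g : Fin n → β)
    (hfg : ∀ b, (Finset.univ.filter fun x => f x = b).card = (Finset.univ.filter fun x => g x = b).card) :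
    ∃ σ : Equiv.Perm (Fin n), ∀ i, f (σ i) = g i := by
  classical
  have e : ∀ b, {x // g x = b} ≃ {x // f x = b} := fun b =>
    Fintype.equivOfCardEq (by rw [Fintype.card_subtype, Fintype.card_subtype, hfg b])
  refine ⟨(Equiv.sigmaFiberEquiv g).symm.trans ((Equiv.sigmaCongrRight e).trans (Equiv.sigmaFiberEquiv f)), fun i => ?_⟩
  simp only [Equiv.trans_apply, Equiv.sigmaCongrRight_apply, Equiv.sigmaFiberEquiv_apply]
  exact ((e (g i)) ⟨i, rfl⟩).2

/-! ## 3. Run-length type functions from count data -/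

/-- The run-length list of the alphabet with multiplicities `ks` (aligned lists). -/
def rlList : List (Fin 64) → List ℕ → List (Fin 64)
  | τ :: rest, k :: ks => List.replicate k τ ++ rlList rest ks
  | _, _ => []

/-- The count of `τ` in the run-length list is its multiplicity (alphabet without duplicates). -/
theorem count_rlList_map (alphabet : List (Fin 64)) (hnd : alphabet.Nodup) (cnt : Fin 64 → ℕ) (τ : Fin 64) :
    (rlList alphabet (alphabet.map cnt)).count τ = if τ ∈ alphabet then cnt τ else 0 := by
  induction alphabet with
  | nil => simp [rlList]
  | cons σ rest ih =>
    rw [List.map_cons, rlList, List.count_append, ih (List.nodup_cons.mp hnd).2, List.count_replicate]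
    have hσ : σ ∉ rest := (List.nodup_cons.mp hnd).1
    by_cases h1 : τ = σ
    · subst h1; simp [hσ]
    · have : ¬ σ = τ := fun h => h1 h.symm
      simp [h1, this, List.mem_cons]

/-- The length of the run-length list is the total multiplicity. -/
theorem length_rlList_map (alphabet : List (Fin 64)) (cnt : Fin 64 → ℕ) :
    (rlList alphabet (alphabet.map cnt)).length = (alphabet.map cnt).sum := by
  induction alphabet with
  | nil => simp [rlList]
  | cons σ rest ih => simp [rlList, ih]

/-- The type function of a run-length list: `i ↦ L[i]`. -/
def rlFun (L : List (Fin 64)) : Fin L.length → Fin 64 := fun i => L.get i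

/-- The fibre sizes of `rlFun L` are the counts of `L`. -/
theorem card_fiber_rlFun (L : List (Fin 64)) (τ : Fin 64) :
    (Finset.univ.filter fun i => rlFun L i = τ).card = L.count τ := by
  have := Fin.card_filter_univ_eq_vector_get_eq_count τ (⟨L, rfl⟩ : List.Vector (Fin 64) L.length)
  simpa [rlFun, List.Vector.get] using this

/-! ## 4. The budgeted enumerator of sorted type lists and its completeness -/

/-- The incidence bits of a type as naturals: `bitN τ i = [bit i of τ]`. -/
def bitN (τ : Fin 64) (i : Fin 6) : ℕ := if τ.val.testBit i.val then 1 else 0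

/-- The total number of set bits among the six. -/
def bitSum (τ : Fin 64) : ℕ := bitN τ 0 + bitN τ 1 + bitN τ 2 + bitN τ 3 + bitN τ 4 + bitN τ 5

/-- **The enumerator**: all run-length lists over `alphabet` (in alphabet order) whose incidence counts are EXACTLY `R`
(`Σ_x bit_i(type x) = R i` for the six bits).  Coordinate by coordinate: either one more coordinate of the current type (if its bits fit
and it has a bit at all) or move to the next type; the measure `(|alphabet|, Σ R)` decreases. -/
def enumSeq : List (Fin 64) → (Fin 6 → ℕ) → List (List (Fin 64))
  | [], R => if ∀ i, R i = 0 then [[]] else []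
  | τ :: rest, R =>
    (if 0 < bitSum τ ∧ ∀ i, bitN τ i ≤ R i then (enumSeq (τ :: rest) (fun i => R i - bitN τ i)).map (fun L => τ :: L) else []) ++
      enumSeq rest R
termination_by alphabet R => (alphabet.length, R 0 + R 1 + R 2 + R 3 + R 4 + R 5)
decreasing_by
  · apply Prod.Lex.right'
    · simp
    · have hh := ‹0 < bitSum τ ∧ ∀ i, bitN τ i ≤ R i›
      have h0 := hh.2 0; have h1 := hh.2 1; have h2 := hh.2 2; have h3 := hh.2 3; have h4 := hh.2 4; have h5 := hh.2 5
      have hp := hh.1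
      simp only [bitSum] at hp
      omega
  · apply Prod.Lex.left; simp

/-- Summing over `alphabet.zip (alphabet.map f)` is summing over `alphabet`. -/
theorem sum_zip_map_self (l : List (Fin 64)) (f : Fin 64 → ℕ) (i : Fin 6) :
    ((l.zip (l.map f)).map fun τk => τk.2 * bitN τk.1 i).sum = (l.map fun τ => f τ * bitN τ i).sum := by
  induction l with
  | nil => simp
  | cons τ rest ih => simp [ih]

/-- **COMPLETENESS of the enumerator**: the run-length list of any multiplicity assignment with exact incidence counts is enumerated
(alphabet of types with at least one bit). -/
theorem rlList_mem_enumSeq (alphabet : List (Fin 64)) (hpos : ∀ τ ∈ alphabet, 0 < bitSum τ) (ks : List ℕ) (hlen : ks.length = alphabet.length)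
    (R : Fin 6 → ℕ) (hR : ∀ i, ((alphabet.zip ks).map fun τk => τk.2 * bitN τk.1 i).sum = R i) :
    rlList alphabet ks ∈ enumSeq alphabet R := by
  induction alphabet generalizing ks R with
  | nil =>
    cases ks with
    | nil =>
      simp only [List.zip_nil_right, List.map_nil, List.sum_nil] at hR
      rw [show rlList [] [] = [] from rfl, enumSeq, if_pos (fun i => (hR i).symm)]; simp
    | cons _ _ => simp at hlen
  | cons τ rest ih =>
    cases ks with
    | nil => simp at hlen
    | cons k ks' =>
      simp only [List.length_cons, Nat.succ.injEq] at hlen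
      simp only [List.zip_cons_cons, List.map_cons, List.sum_cons] at hR
      have hτ : 0 < bitSum τ := hpos τ (List.mem_cons_self)
      have hrest : ∀ σ ∈ rest, 0 < bitSum σ := fun σ hσ => hpos σ (List.mem_cons_of_mem _ hσ)
      -- peel the `k` copies of `τ`
      induction k generalizing R with
      | zero =>
        rw [rlList, List.replicate_zero, List.nil_append, enumSeq]
        exact List.mem_append_right _ (ih hrest ks' hlen R (fun i => by simpa using hR i))
      | succ k ihk =>
        have hfit : ∀ i, bitN τ i ≤ R i := fun i => by have := hR i; rw [Nat.succ_mul] at this; omega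
        rw [rlList, List.replicate_succ, List.cons_append, enumSeq, if_pos ⟨hτ, hfit⟩]
        refine List.mem_append_left _ (List.mem_map.mpr ⟨_, ?_, rfl⟩)
        have := ihk (fun i => R i - bitN τ i) (fun i => by have := hR i; rw [← this]; rw [Nat.succ_mul] ; omega)
        rwa [rlList] at this

end BallCut

end Summit.ValiantsHypothesis.ValiantsHypothesis.Theorems.BarrierLever.HiddenStates
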